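import Mathlib.Analysis.Convex.Radon
import Mathlib.LinearAlgebra.Matrix.PosDef
import Mathlib.LinearAlgebra.Dimension.Constructions
import Literature.LinearAlgebra.Matrix.MinkowskiDet
import Literature.Computability.Complexity.ExtMonotoneGates

/-!
# CONV gates of bounded psd dimension have bounded effective row number (Helly reduction)

Crux `ConvexRankGates.CliqueExtLowerBound` (stmt-PneNP-10682), line `width-threshold-certificate-sparsity`,
stub `stub_convHighDim` (CONV gates with `p ≥ 3` constraint rows and psd dimension `q ≥ 2`).

A CONV gate accepts `v` iff the semidefinite system `∃ Y ⪰ 0, tr(Aᵢ Y) ≤ βᵢ(v)` (`i < p`,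
`βᵢ(v) = bᵢ + ∑ⱼ Bᵢⱼ [vⱼ]`) is feasible. The feasible sets of the single rows,
`Sᵢ = {Y ⪰ 0 | tr(Aᵢ Y) ≤ βᵢ}`, are convex subsets of the `q²`-dimensional real vector space of
`q × q` matrices, so by HELLY'S THEOREM the whole system is feasible iff every sub-system of at
most `q² + 1` rows is feasible (`sdpFeasible_iff_forall_card_le`). Consequently a CONV gate of psd
dimension `q` with ANY number `p` of rows is the conjunction, over the `≤ (p+1)^{q²+1}` row sets
`I` with `#I ≤ q² + 1`, of the CONV gates with data `(A|_I, b|_I, B|_I)` — the same psd dimension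
and at most `q² + 1` rows (`convAccepts_iff_forall_subsystems`, `subsystem_reindex`). For the line
this says: for every FIXED psd dimension `q₀` the open residual `stub_convHighDim` is already the
case `p ≤ q₀² + 1` (an AND of polynomially many such gates); in particular the first open case is
`(p, q) = (3, 2)` … `(5, 2)` and nothing else at `q = 2`.

Lead prover seat `prover-line-stmt-PneNP-10682-c2`, 2026-08-16.
-/

set_option linter.dupNamespace false

namespace Summit.PneNP.PneNP.Theorems.CliqueExtLowerBound.WidthThreshold.ConvHelly

open Matrix Finset Module

/-- The feasible set of one row of a semidefinite system, `{Y ⪰ 0 | tr(A Y) ≤ β}`, is convex.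
[folklore] -/
theorem convex_rowSet {q : ℕ} (A : Matrix (Fin q) (Fin q) ℝ) (β : ℝ) :
    Convex ℝ {Y : Matrix (Fin q) (Fin q) ℝ | Y.PosSemidef ∧ (A * Y).trace ≤ β} := by
  intro Y hY Z hZ a c ha hc hac
  refine ⟨(hY.1.smul ha).add (hZ.1.smul hc), ?_⟩
  have h1 : (A * (a • Y + c • Z)).trace = a * (A * Y).trace + c * (A * Z).trace := by
    rw [Matrix.mul_add, Matrix.mul_smul, Matrix.mul_smul, trace_add, trace_smul, trace_smul,
      smul_eq_mul, smul_eq_mul]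
  rw [Set.mem_setOf_eq] at hY hZ
  rw [h1]
  calc a * (A * Y).trace + c * (A * Z).trace ≤ a * β + c * β :=
        add_le_add (mul_le_mul_of_nonneg_left hY.2 ha) (mul_le_mul_of_nonneg_left hZ.2 hc)
    _ = β := by rw [← add_mul, hac, one_mul]

/-- **Helly reduction for semidefinite feasibility.** A system `∃ Y ⪰ 0, ∀ i < p, tr(Aᵢ Y) ≤ βᵢ`
in a `q × q` matrix variable is feasible iff every sub-system of at most `q² + 1` rows is feasible
(Helly's theorem in the `q²`-dimensional space of `q × q` real matrices, applied to the convex row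
sets `{Y ⪰ 0 | tr(Aᵢ Y) ≤ βᵢ}`). [folklore] -/
theorem sdpFeasible_iff_forall_card_le {p q : ℕ} (A : Fin p → Matrix (Fin q) (Fin q) ℝ)
    (β : Fin p → ℝ) :
    (∃ Y : Matrix (Fin q) (Fin q) ℝ, Y.PosSemidef ∧ ∀ i, (A i * Y).trace ≤ β i) ↔
      ∀ I : Finset (Fin p), #I ≤ q * q + 1 →
        ∃ Y : Matrix (Fin q) (Fin q) ℝ, Y.PosSemidef ∧ ∀ i ∈ I, (A i * Y).trace ≤ β i := by
  constructor
  · rintro ⟨Y, hY, h⟩ I -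
    exact ⟨Y, hY, fun i _ => h i⟩
  · intro h
    rcases Nat.eq_zero_or_pos p with hp | hp
    · subst hp
      obtain ⟨Y, hY, -⟩ := h ∅ (by simp)
      exact ⟨Y, hY, fun i => i.elim0⟩
    · -- Helly in the space of `q × q` real matrices (dimension `q * q`).
      have hdim : finrank ℝ (Matrix (Fin q) (Fin q) ℝ) = q * q := by
        simp [Module.finrank_matrix]
      have hne : (⋂ i ∈ (univ : Finset (Fin p)),
          {Y : Matrix (Fin q) (Fin q) ℝ | Y.PosSemidef ∧ (A i * Y).trace ≤ β i}).Nonempty := by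
        refine Convex.helly_theorem' (𝕜 := ℝ) (fun i _ => convex_rowSet (A i) (β i)) ?_
        intro I _ hI
        rw [hdim] at hI
        obtain ⟨Y, hY, hrows⟩ := h I hI
        exact ⟨Y, Set.mem_iInter₂.2 fun i hi => ⟨hY, hrows i hi⟩⟩
      obtain ⟨Y, hYmem⟩ := hne
      have hall : ∀ i, Y.PosSemidef ∧ (A i * Y).trace ≤ β i := fun i =>
        (Set.mem_iInter₂.1 hYmem) i (mem_univ i)
      exact ⟨Y, (hall ⟨0, hp⟩).1, fun i => (hall i).2⟩

/-- The right-hand side of row `i` of a CONV gate at the input `v`: `bᵢ + ∑ⱼ Bᵢⱼ [vⱼ]`.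
[folklore] -/
theorem convAccepts_iff_forall_subsystems {n p q : ℕ} (A : Fin p → Matrix (Fin q) (Fin q) ℝ)
    (b : Fin p → ℝ) (B : Fin p → Fin n → ℝ) (v : Fin n → Bool) :
    (∃ Y : Matrix (Fin q) (Fin q) ℝ, Y.PosSemidef ∧
        ∀ i, (A i * Y).trace ≤ b i + ∑ j, B i j * (if v j then (1 : ℝ) else 0)) ↔
      ∀ I : Finset (Fin p), #I ≤ q * q + 1 →
        ∃ Y : Matrix (Fin q) (Fin q) ℝ, Y.PosSemidef ∧
          ∀ i ∈ I, (A i * Y).trace ≤ b i + ∑ j, B i j * (if v j then (1 : ℝ) else 0) :=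
  sdpFeasible_iff_forall_card_le A fun i => b i + ∑ j, B i j * (if v j then (1 : ℝ) else 0)

/-- **Re-indexing a sub-system as CONV data with `#I` rows.** The sub-system of the rows `i ∈ I`
of CONV data `(A, b, B)` (psd dimension `q`, `B ≥ 0`) is itself CONV data `(A', b', B')` with
`#I` rows, the same psd dimension and `B' ≥ 0`, accepting exactly the same inputs. [folklore] -/
theorem subsystem_reindex {n p q : ℕ} (A : Fin p → Matrix (Fin q) (Fin q) ℝ) (b : Fin p → ℝ)
    (B : Fin p → Fin n → ℝ) (hB : ∀ i j, 0 ≤ B i j) (I : Finset (Fin p)) :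
    ∃ (A' : Fin #I → Matrix (Fin q) (Fin q) ℝ) (b' : Fin #I → ℝ) (B' : Fin #I → Fin n → ℝ),
      (∀ i j, 0 ≤ B' i j) ∧ ∀ v : Fin n → Bool,
        (∃ Y : Matrix (Fin q) (Fin q) ℝ, Y.PosSemidef ∧
            ∀ i ∈ I, (A i * Y).trace ≤ b i + ∑ j, B i j * (if v j then (1 : ℝ) else 0)) ↔
          ∃ Y : Matrix (Fin q) (Fin q) ℝ, Y.PosSemidef ∧
            ∀ i' : Fin #I, (A' i' * Y).trace ≤ b' i' + ∑ j, B' i' j * (if v j then (1 : ℝ) else 0) := by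
  classical
  let e : I ≃ Fin #I := I.equivFin
  refine ⟨fun i' => A (e.symm i'), fun i' => b (e.symm i'), fun i' => B (e.symm i'),
    fun i' j => hB _ _, fun v => ?_⟩
  constructor
  · rintro ⟨Y, hY, h⟩
    exact ⟨Y, hY, fun i' => h _ (e.symm i').2⟩
  · rintro ⟨Y, hY, h⟩
    refine ⟨Y, hY, fun i hi => ?_⟩
    have := h (e ⟨i, hi⟩)
    simpa only [Equiv.symm_apply_apply] using this

open Literature.Computability.Complexity in
/-- **CONV gates of psd dimension `q` are ANDs of CONV gates with `≤ q² + 1` rows** (gate form of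
the Helly reduction, for the stub `stub_convHighDim` of line `width-threshold-certificate-sparsity`):
if `φ` is computed by CONV data with `p` rows and psd dimension `q`, then for every row set `I`
with `#I ≤ q² + 1` there are CONV data with `#I` rows, psd dimension `q` and non-negative `B'`
computing a Boolean function `f_I`, and `φ v = 1 ↔ ∀ I, #I ≤ q²+1 → f_I v = 1`. The number of
conjuncts is at most the number of such `I`, i.e. `≤ ∑_{t ≤ q²+1} C(p, t) ≤ (p+1)^{q²+1}`.
[folklore] -/
theorem conv_eq_forall_fewRows (φ : GateFn) (p q : ℕ) (A : Fin p → Matrix (Fin q) (Fin q) ℝ)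
    (b : Fin p → ℝ) (B : Fin p → Fin φ.1 → ℝ) (hB : ∀ i j, 0 ≤ B i j)
    (hφ : ∀ v : Fin φ.1 → Bool, φ.2 v = true ↔
      ∃ Y : Matrix (Fin q) (Fin q) ℝ, Y.PosSemidef ∧
        ∀ i, (A i * Y).trace ≤ b i + ∑ j, B i j * (if v j then (1 : ℝ) else 0)) :
    ∃ f : Finset (Fin p) → (Fin φ.1 → Bool) → Bool,
      (∀ I : Finset (Fin p), ∃ (A' : Fin #I → Matrix (Fin q) (Fin q) ℝ) (b' : Fin #I → ℝ)
        (B' : Fin #I → Fin φ.1 → ℝ), (∀ i j, 0 ≤ B' i j) ∧ ∀ v : Fin φ.1 → Bool, f I v = true ↔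
          ∃ Y : Matrix (Fin q) (Fin q) ℝ, Y.PosSemidef ∧
            ∀ i' : Fin #I, (A' i' * Y).trace ≤ b' i' + ∑ j, B' i' j * (if v j then (1 : ℝ) else 0)) ∧
      ∀ v : Fin φ.1 → Bool, φ.2 v = true ↔ ∀ I : Finset (Fin p), #I ≤ q * q + 1 → f I v = true := by
  classical
  refine ⟨fun I v => decide (∃ Y : Matrix (Fin q) (Fin q) ℝ, Y.PosSemidef ∧
      ∀ i ∈ I, (A i * Y).trace ≤ b i + ∑ j, B i j * (if v j then (1 : ℝ) else 0)), fun I => ?_,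
    fun v => ?_⟩
  · obtain ⟨A', b', B', hB', hiff⟩ := subsystem_reindex A b B hB I
    exact ⟨A', b', B', hB', fun v => by rw [decide_eq_true_eq]; exact hiff v⟩
  · rw [hφ v, convAccepts_iff_forall_subsystems]
    simp only [decide_eq_true_eq]

open Literature.Computability.Complexity in
/-- **Width bookkeeping**: each conjunct of `conv_eq_forall_fewRows` with `#I ≤ q² + 1` is a CONV
gate of width `≤ q² + 1 + q` (rows + psd dimension), independently of `p`. [folklore] -/
theorem fewRows_isConvGate {n q t : ℕ} (f : (Fin n → Bool) → Bool)
    (A' : Fin t → Matrix (Fin q) (Fin q) ℝ) (b' : Fin t → ℝ) (B' : Fin t → Fin n → ℝ)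
    (hB' : ∀ i j, 0 ≤ B' i j) (ht : t ≤ q * q + 1)
    (hf : ∀ v : Fin n → Bool, f v = true ↔ ∃ Y : Matrix (Fin q) (Fin q) ℝ, Y.PosSemidef ∧
      ∀ i' : Fin t, (A' i' * Y).trace ≤ b' i' + ∑ j, B' i' j * (if v j then (1 : ℝ) else 0)) :
    IsConvGate (q * q + 1 + q) ⟨n, f⟩ :=
  ⟨t, q, by omega, A', b', B', hB', hf⟩

/-- **Registered form** (helper sub-goal `conv_helly_reduction` of `stub_convHighDim`, crux
stmt-PneNP-10682): semidefinite feasibility in a `q × q` matrix variable is decided by the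
sub-systems of at most `q² + 1` rows. [folklore] -/
theorem conv_helly_reduction : ∀ (p q : ℕ) (A : Fin p → Matrix (Fin q) (Fin q) ℝ) (β : Fin p → ℝ),
    (∃ Y : Matrix (Fin q) (Fin q) ℝ, Y.PosSemidef ∧ ∀ i, (A i * Y).trace ≤ β i) ↔
      ∀ I : Finset (Fin p), #I ≤ q * q + 1 →
        ∃ Y : Matrix (Fin q) (Fin q) ℝ, Y.PosSemidef ∧ ∀ i ∈ I, (A i * Y).trace ≤ β i :=
  fun _ _ A β => sdpFeasible_iff_forall_card_le A β

end Summit.PneNP.PneNP.Theorems.CliqueExtLowerBound.WidthThreshold.ConvHelly
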